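import Mathlib.NumberTheory.FLT.Four
import Mathlib.Data.ZMod.Basic
import Mathlib.Tactic
import HarnessLib

/-!
# No elliptic curve over `ℚ` has everywhere good reduction (Tate) — part 1: the diophantine core

The classical theorem «there is no elliptic curve over `ℚ` with everywhere good reduction» (equivalently: no
elliptic curve of conductor `1`; Tate; Ogg 1966; Silverman, AEC, Exercise 8.15) reduces, through
`1728·Δ = c₄³ − c₆²` and the parity/`3`-adic shape of `(c₄, c₆)` on an integral model with `Δ = ±1`
(`c₄` odd; `3 ∣ c₄ ⇒ 27 ∣ c₆`), to the following purely arithmetic statement, proved here: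

  `Int.no_solution_cubed_sub_sq_eq_1728`: there are no integers `x, y` with `x` odd, `3 ∣ x → 27 ∣ y`, and
  `x³ − y² = ±1728`.

Proof (elementary, the route of Silverman's Exercise 8.15): `x³ ∓ 12³ = (x ∓ 12)(x² ± 12x + 144)` and the
quadratic factor `Q ≡ 5 (mod 8)`; any common divisor of the two factors divides `432 = 2⁴·3³`; if `3 ∤ x` the
factors are coprime, so `Q` is a square — impossible mod `8`; if `3 ∣ x` then `27 ∣ y`, and `x = 3x₁`, `y = 27y₁`
give `(x₁ ∓ 4)(x₁² ± 4x₁ + 16) = 27y₁²` with the quadratic factor `Q₁ ≡ 5 (mod 8)` and common divisors dividing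
`48`; either `3 ∤ Q₁` (then `27 ∣ x₁ ∓ 4` and `Q₁` is a square) or `Q₁ = 3Q₂` with `3 ∤ Q₂`, `9 ∣ x₁ ∓ 4`, and
`Q₂ ≡ 7 (mod 8)` is a square — contradictions mod `8` in all cases.

Part 2 (`NoConductorOne.lean`) draws the consequences for Weierstrass models and conductors.

References: J. Silverman, *The Arithmetic of Elliptic Curves*, GTM 106 (2009), Exercise 8.15 [SilvermanAEC2009].
-/

namespace Int

/-- An integer congruent to `5` or `7` modulo `8` is not a square. [folklore] -/
private theorem ne_sq_of_emod_eight {q : ℤ} (h : q % 8 = 5 ∨ q % 8 = 7) (d : ℤ) : q ≠ d ^ 2 := by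
  rintro rfl
  have key : ∀ z : ZMod 8, z ^ 2 ≠ 5 ∧ z ^ 2 ≠ 7 := by decide
  have hmod : (((d ^ 2 % 8 : ℤ)) : ZMod 8) = (d : ZMod 8) ^ 2 := by
    have := ZMod.intCast_mod (d ^ 2) 8
    push_cast at this ⊢
    exact this
  rcases h with h | h <;> rw [h] at hmod <;> push_cast at hmod
  · exact (key _).1 hmod.symm
  · exact (key _).2 hmod.symm

/-- If `a·Q = y²` with `gcd(a, Q) = 1` and `Q > 0` then `Q` is a square. [folklore] -/
private theorem exists_sq_of_gcd_eq_one_mul_eq_sq {a Q y : ℤ} (hcop : Int.gcd a Q = 1) (hfac : a * Q = y ^ 2)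
    (hQ : 0 < Q) : ∃ d, Q = d ^ 2 := by
  obtain ⟨d, hd | hd⟩ := Int.sq_of_gcd_eq_one (Int.gcd_comm a Q ▸ hcop) (by rw [mul_comm]; exact hfac)
  · exact ⟨d, hd⟩
  · exfalso; nlinarith [sq_nonneg d]

/-- A natural number dividing `432 = 2⁴·3³` and divisible by neither `2` nor `3` is `1`. [folklore] -/
private theorem nat_eq_one_of_dvd_432 {g : ℕ} (hg : g ∣ 432) (h2 : ¬ 2 ∣ g) (h3 : ¬ 3 ∣ g) : g = 1 := by
  have h2' : Nat.Coprime g 2 := ((Nat.Prime.coprime_iff_not_dvd Nat.prime_two).mpr h2).symm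
  have h3' : Nat.Coprime g 3 := ((Nat.Prime.coprime_iff_not_dvd Nat.prime_three).mpr h3).symm
  have h432 : Nat.Coprime g 432 := by
    rw [show (432 : ℕ) = 2 ^ 4 * 3 ^ 3 by norm_num]
    exact (h2'.pow_right 4).mul_right (h3'.pow_right 3)
  exact Nat.Coprime.eq_one_of_dvd h432 hg

/-- **The coprime-square step.** If `a·Q = y²` with `Q = a·u + m`, `m ∣ 432`, `a` odd, `Q > 0`, and `3` does not
divide both `a` and `Q`, then `Q` is a perfect square (every common divisor of `a` and `Q` divides `m`, is odd, and is
prime to `3`). [cite: SilvermanAEC2009, Exercise 8.15] -/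
theorem exists_sq_of_mul_eq_sq {a Q u m y : ℤ} (hfac : a * Q = y ^ 2) (hlin : Q = a * u + m) (hm : m ∣ 432)
    (ha : Odd a) (h3 : ¬ (3 : ℤ) ∣ a ∨ ¬ (3 : ℤ) ∣ Q) (hQ : 0 < Q) : ∃ d, Q = d ^ 2 := by
  refine exists_sq_of_gcd_eq_one_mul_eq_sq ?_ hfac hQ
  set g : ℕ := Int.gcd a Q with hg
  have hga : (g : ℤ) ∣ a := Int.gcd_dvd_left ..
  have hgQ : (g : ℤ) ∣ Q := Int.gcd_dvd_right ..
  have hgm : (g : ℤ) ∣ m := by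
    have : m = Q - a * u := by rw [hlin]; ring
    rw [this]
    exact dvd_sub hgQ (hga.mul_right u)
  have hg432 : g ∣ 432 := by
    have : (g : ℤ) ∣ (432 : ℤ) := dvd_trans hgm hm
    exact_mod_cast this
  have hg2 : ¬ 2 ∣ g := by
    intro h2
    have : (2 : ℤ) ∣ a := dvd_trans (by exact_mod_cast h2) hga
    obtain ⟨k, hk⟩ := ha
    omega
  have hg3 : ¬ 3 ∣ g := by
    intro h3g
    have h3' : (3 : ℤ) ∣ (g : ℤ) := by exact_mod_cast h3g
    rcases h3 with h | h
    · exact h (dvd_trans h3' hga)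
    · exact h (dvd_trans h3' hgQ)
  exact nat_eq_one_of_dvd_432 hg432 hg2 hg3

/-- `gcd(3^k, n) = 1` when `3 ∤ n`, in the `IsCoprime` form used for `dvd_of_dvd_mul_right`. [folklore] -/
private theorem isCoprime_three_pow_of_not_dvd {n : ℤ} (h : ¬ (3 : ℤ) ∣ n) (k : ℕ) : IsCoprime ((3 : ℤ) ^ k) n := by
  refine IsCoprime.pow_left (Int.isCoprime_iff_gcd_eq_one.mpr ?_)
  have h1 : ((Int.gcd 3 n : ℕ) : ℤ) ∣ 3 := Int.gcd_dvd_left ..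
  have h2 : ((Int.gcd 3 n : ℕ) : ℤ) ∣ n := Int.gcd_dvd_right ..
  have h1' : Int.gcd 3 n ∣ 3 := by exact_mod_cast h1
  rcases (Nat.dvd_prime Nat.prime_three).mp h1' with h3 | h3
  · exact h3
  · exfalso; rw [h3] at h2; exact h (by exact_mod_cast h2)

/-- For odd `x` and `σ = ±1`: `x² + 12σx + 144 ≡ 5 (mod 8)` and `x² + 4σx + 16 ≡ 5 (mod 8)`. [folklore] -/
private theorem quad_emod_eight_of_odd {x σ : ℤ} (hx : Odd x) (hσ : σ = 1 ∨ σ = -1) :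
    (x ^ 2 + 12 * σ * x + 144) % 8 = 5 ∧ (x ^ 2 + 4 * σ * x + 16) % 8 = 5 := by
  obtain ⟨k, rfl⟩ := hx
  obtain ⟨m, hm⟩ := Int.even_mul_succ_self k
  have h1 : (2 * k + 1) ^ 2 + 12 * σ * (2 * k + 1) + 144 = 4 * (k * (k + 1)) + (24 * σ * k + 12 * σ + 145) := by
    ring
  have h2 : (2 * k + 1) ^ 2 + 4 * σ * (2 * k + 1) + 16 = 4 * (k * (k + 1)) + (8 * σ * k + 4 * σ + 17) := by
    ring
  rw [h1, h2, hm]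
  rcases hσ with rfl | rfl <;> constructor <;> omega

/-- The quadratic factor modulo `9` at level `1`: if `3 ∣ x₁² + 4σx₁ + 16` (`σ = ±1`) then
`x₁² + 4σx₁ + 16 ≡ 3 (mod 9)`. [folklore] -/
private theorem quad_eq_nine_mul_add_three {x₁ σ : ℤ} (hσ : σ = 1 ∨ σ = -1) (h3 : (3 : ℤ) ∣ x₁ ^ 2 + 4 * σ * x₁ + 16) :
    ∃ s : ℤ, x₁ ^ 2 + 4 * σ * x₁ + 16 = 9 * s + 3 := by
  obtain ⟨c, hc⟩ := h3
  obtain ⟨q, hq⟩ : ∃ q, x₁ = 9 * q + x₁ % 9 := ⟨x₁ / 9, by omega⟩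
  have hr0 : 0 ≤ x₁ % 9 := Int.emod_nonneg _ (by norm_num)
  have hr9 : x₁ % 9 < 9 := Int.emod_lt_of_pos _ (by norm_num)
  generalize hr : x₁ % 9 = r at hq hr0 hr9
  have hexp : x₁ ^ 2 + 4 * σ * x₁ + 16 = 9 * (9 * q ^ 2 + 2 * q * r + 4 * σ * q) + (r ^ 2 + 4 * σ * r + 16) := by
    rw [hq]; ring
  generalize hB : 9 * q ^ 2 + 2 * q * r + 4 * σ * q = B at hexp
  rw [hexp] at hc ⊢
  refine ⟨B + (r ^ 2 + 4 * σ * r + 16 - 3) / 9, ?_⟩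
  have hcases : r = 0 ∨ r = 1 ∨ r = 2 ∨ r = 3 ∨ r = 4 ∨ r = 5 ∨ r = 6 ∨ r = 7 ∨ r = 8 := by omega
  rcases hσ with rfl | rfl <;> rcases hcases with rfl | rfl | rfl | rfl | rfl | rfl | rfl | rfl | rfl <;>
    norm_num at hc ⊢ <;> omega

/-- **No integers `x, y` with `x` odd, `3 ∣ x → 27 ∣ y`, and `x³ − y² = 1728σ`, `σ = ±1`.**
(The arithmetic core of «no elliptic curve over `ℚ` has everywhere good reduction»: `x = c₄`, `y = c₆` of an integral
model with `Δ = σ`.) [cite: SilvermanAEC2009, Exercise 8.15] -/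
theorem no_solution_cubed_sub_sq_eq_1728 (x y σ : ℤ) (hσ : σ = 1 ∨ σ = -1) (hx : Odd x)
    (h27 : (3 : ℤ) ∣ x → (27 : ℤ) ∣ y) (h : x ^ 3 - y ^ 2 = 1728 * σ) : False := by
  have hσ2 : σ ^ 2 = 1 := by rcases hσ with rfl | rfl <;> norm_num
  have hodd_ne : ∀ {z : ℤ}, Odd z → z ^ 3 ≠ 64 * σ := by
    intro z hz hzw
    have hz3 : Odd (z ^ 3) := hz.pow
    rw [hzw] at hz3
    obtain ⟨k, hk⟩ := hz3
    rcases hσ with rfl | rfl <;> omega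
  -- level 0: `(x − 12σ)·Q = y²`, `Q = x² + 12σx + 144 = (x − 12σ)(x + 24σ) + 432`
  set a := x - 12 * σ with ha
  set Q := x ^ 2 + 12 * σ * x + 144 with hQ
  have hfac : a * Q = y ^ 2 := by
    rw [ha, hQ]; linear_combination h - 144 * x * hσ2
  have hlin : Q = a * (x + 24 * σ) + 432 := by rw [hQ, ha]; linear_combination (288 : ℤ) * hσ2
  have hQpos : 0 < Q := by
    rw [hQ]; nlinarith [sq_nonneg (x + 6 * σ), hσ2]
  have hQ8 : Q % 8 = 5 := (quad_emod_eight_of_odd hx hσ).1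
  have haodd : Odd a := by
    rw [ha]; obtain ⟨k, hk⟩ := hx; rcases hσ with rfl | rfl <;> exact Int.odd_iff.mpr (by omega)
  have hapos : 0 < a := by
    have h0 : 0 ≤ a * Q := by rw [hfac]; positivity
    rcases lt_trichotomy a 0 with hneg | hzero | hpos
    · exfalso; nlinarith
    · exfalso; rw [hzero] at haodd; exact (by decide : ¬ Odd (0 : ℤ)) haodd
    · exact hpos
  by_cases h3 : (3 : ℤ) ∣ x
  · -- level 1: `x = 3x₁`, `y = 27y₁`, `(x₁ − 4σ)·Q₁ = 27y₁²`, `Q₁ = x₁² + 4σx₁ + 16 = (x₁ − 4σ)(x₁ + 8σ) + 48`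
    obtain ⟨x₁, rfl⟩ := h3
    obtain ⟨y₁, rfl⟩ := h27 (dvd_mul_right 3 x₁)
    have hx₁ : Odd x₁ := (Int.odd_mul.mp hx).2
    have h' : x₁ ^ 3 - 27 * y₁ ^ 2 = 64 * σ := by
      have h27' : (27 : ℤ) * (x₁ ^ 3 - 27 * y₁ ^ 2) = 27 * (64 * σ) := by linear_combination h
      exact mul_left_cancel₀ (by norm_num) h27'
    set a₁ := x₁ - 4 * σ with ha₁
    set Q₁ := x₁ ^ 2 + 4 * σ * x₁ + 16 with hQ₁
    have hfac₁ : a₁ * Q₁ = 27 * y₁ ^ 2 := by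
      rw [ha₁, hQ₁]; linear_combination h' - 16 * x₁ * hσ2
    have hlin₁ : Q₁ = a₁ * (x₁ + 8 * σ) + 48 := by rw [hQ₁, ha₁]; linear_combination (32 : ℤ) * hσ2
    have hQ₁pos : 0 < Q₁ := by rw [hQ₁]; nlinarith [sq_nonneg (x₁ + 2 * σ), hσ2]
    have hQ₁8 : Q₁ % 8 = 5 := (quad_emod_eight_of_odd hx₁ hσ).2
    have ha₁odd : Odd a₁ := by
      rw [ha₁]; obtain ⟨k, hk⟩ := hx₁; rcases hσ with rfl | rfl <;> exact Int.odd_iff.mpr (by omega)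
    have hy₁ : y₁ ≠ 0 := by
      rintro rfl
      exact hodd_ne hx₁ (by linear_combination h')
    have ha₁pos : 0 < a₁ := by
      have h0 : 0 < a₁ * Q₁ := by rw [hfac₁]; positivity
      rcases lt_trichotomy a₁ 0 with hneg | hzero | hpos
      · exfalso; nlinarith
      · exfalso; rw [hzero, zero_mul] at h0; exact lt_irrefl _ h0
      · exact hpos
    by_cases h3Q : (3 : ℤ) ∣ Q₁
    · -- `Q₁ = 3·Q₂`, `3 ∤ Q₂`, `Q₂ ≡ 7 (mod 8)`
      obtain ⟨s, hs⟩ := quad_eq_nine_mul_add_three hσ (hQ₁ ▸ h3Q)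
      rw [← hQ₁] at hs
      set Q₂ := 3 * s + 1 with hQ₂
      have hQ₁eq : Q₁ = 3 * Q₂ := by rw [hQ₂]; omega
      have hQ₂3 : ¬ (3 : ℤ) ∣ Q₂ := by rw [hQ₂]; omega
      have hQ₂pos : 0 < Q₂ := by omega
      have hQ₂8 : Q₂ % 8 = 7 := by omega
      -- `9 ∣ a₁` since `a₁·Q₂ = 9y₁²` and `3 ∤ Q₂`
      have h9 : (9 : ℤ) ∣ a₁ := by
        have hcop : IsCoprime (9 : ℤ) Q₂ := by simpa using isCoprime_three_pow_of_not_dvd hQ₂3 2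
        refine hcop.dvd_of_dvd_mul_right ⟨y₁ ^ 2, ?_⟩
        have : 3 * (a₁ * Q₂) = 3 * (9 * y₁ ^ 2) := by
          linear_combination (-1 : ℤ) * a₁ * hQ₁eq + hfac₁
        exact mul_left_cancel₀ (by norm_num) this
      obtain ⟨A, hA⟩ := h9
      have hfac₂ : A * Q₂ = y₁ ^ 2 := by
        have : (27 : ℤ) * (A * Q₂) = 27 * y₁ ^ 2 := by
          rw [← hfac₁, hA, hQ₁eq]; ring
        exact mul_left_cancel₀ (by norm_num) this
      have hlin₂ : Q₂ = A * (3 * (x₁ + 8 * σ)) + 16 := by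
        have : (3 : ℤ) * Q₂ = 3 * (A * (3 * (x₁ + 8 * σ)) + 16) := by
          rw [← hQ₁eq, hlin₁, hA]; ring
        exact mul_left_cancel₀ (by norm_num) this
      have hAodd : Odd A := by
        rcases Int.even_or_odd A with he | ho
        · exfalso; obtain ⟨k, hk⟩ := he; obtain ⟨j, hj⟩ := ha₁odd; omega
        · exact ho
      obtain ⟨d, hd⟩ := exists_sq_of_mul_eq_sq hfac₂ hlin₂ (by norm_num) hAodd (Or.inr hQ₂3) hQ₂pos
      exact ne_sq_of_emod_eight (Or.inr hQ₂8) d hd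
    · -- `3 ∤ Q₁`: `27 ∣ a₁`, then `(a₁/27)·Q₁ = y₁²`
      have h27a : (27 : ℤ) ∣ a₁ := by
        have hcop : IsCoprime (27 : ℤ) Q₁ := by simpa using isCoprime_three_pow_of_not_dvd h3Q 3
        exact hcop.dvd_of_dvd_mul_right ⟨y₁ ^ 2, by linear_combination hfac₁⟩
      obtain ⟨t, ht⟩ := h27a
      have hfac₂ : t * Q₁ = y₁ ^ 2 := by
        have : (27 : ℤ) * (t * Q₁) = 27 * y₁ ^ 2 := by rw [← hfac₁, ht]; ring
        exact mul_left_cancel₀ (by norm_num) this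
      have hlin₂ : Q₁ = t * (27 * (x₁ + 8 * σ)) + 48 := by rw [hlin₁, ht]; ring
      have htodd : Odd t := by
        rcases Int.even_or_odd t with he | ho
        · exfalso; obtain ⟨k, hk⟩ := he; obtain ⟨j, hj⟩ := ha₁odd; omega
        · exact ho
      obtain ⟨d, hd⟩ := exists_sq_of_mul_eq_sq hfac₂ hlin₂ (by norm_num) htodd (Or.inr h3Q) hQ₁pos
      exact ne_sq_of_emod_eight (Or.inl hQ₁8) d hd
  · -- `3 ∤ x`: `a` and `Q` are coprime
    have h3a : ¬ (3 : ℤ) ∣ a := by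
      rw [ha]; intro h3a
      exact h3 (by rcases hσ with rfl | rfl <;> omega)
    obtain ⟨d, hd⟩ := exists_sq_of_mul_eq_sq hfac hlin (by norm_num) haodd (Or.inl h3a) hQpos
    exact ne_sq_of_emod_eight (Or.inl hQ8) d hd

end Int
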